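import Literature.AlgebraicGeometry.HodgeTheory.WeilClassesTensorPointFieldLines
import HarnessLib

/-!
# `A₀ ⊗ E` for every QUARTIC `E = ℚ[x]/(P)`: the companion tensor fourfold-power `(T × T) × (T × T)` and its Weil classes

Family `hodge`, layer `Literature/AlgebraicGeometry/HodgeTheory`. The CONCRETE companion tensor structure of degree `4` — discharging every
structural hypothesis of `WeilClassesTensorPointField(Lines)` — for an arbitrary monic quartic `P = x⁴ + a₃x³ + a₂x² + a₁x + a₀ ∈ ℤ[x]`:
on `A = (T × T) × (T × T)` (coordinates `(x₀, x₁, x₂, x₃)`, projections `q₀..q₃`) the endomorphism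

  `φ_P (x₀, x₁, x₂, x₃) = (-a₀x₃, x₀ - a₁x₃, x₁ - a₂x₃, x₂ - a₃x₃)`

(multiplication by `x` on `T ⊗_ℤ ℤ[x]/(P)` in the basis `1, x, x², x³`) satisfies the companion relations (`companionFour_comp`), `u = (x₀, 2x₁, 4x₂, 8x₃)`
separates (`separatingFour_comp`), `s₀ = (x, 0, 0, 0)` is a section of `q₀` killing `q₁, q₂, q₃` (`sectionFour_comp`), and `dim A = 4·dim T`. Hence
(`weilClassesField_companionFour_le_algebraicClasses`): **for every complex abelian variety `T` of dimension `g ≥ 1` and every monic quartic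
`P ∈ ℤ[x]` with four distinct complex roots, ALL Weil classes of `(A, φ_P)` — `weilClassesField A φ_P P' (2g)` for every `P'` — are algebraic.**
This covers the tensor points `T ⊗ O` of EVERY quartic CM field `E` (`O = ℤ[x]/(P)`, `P` the minimal polynomial of a generator: `ℚ(ζ₅)`, `ℚ(ζ₈)`
— cf. `WeilClassesFieldSplitSquareZetaEight`, the same variety with `P = x⁴ + 1` up to the coordinate permutation `(0,2,1,3)` —, `ℚ(ζ₁₂)`, the
biquadratic `ℚ(√-d, √e)`, …): the body of the ladder's rung R3 (`WeilClassesCMField`, `e = 4`, `m = g`) on the `g(g+1)/2`-dimensional loci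
`{T ⊗ E}`, fact-free. The four roots are an INPUT (`r : Fin 4 → ℂ` injective with `P(r_k) = 0`), supplied per field by the consumer.

## References

* [Deligne1982HodgeCycles] P. Deligne, LNM 900 (1982), §4 Lemma 4.5, Remark 4.10.
* [MoonenZarhin1998WeilClasses] B. Moonen, Yu. Zarhin, Weil classes on abelian varieties (1998), §1.
-/

noncomputable section

open CategoryTheory

namespace Literature.AlgebraicGeometry.HodgeTheory

open Literature.AlgebraicTopology.SingularHomology
open Literature.AlgebraicGeometry.Motives

section HodgeTheory

variable (T : Motives.AbelianVariety ℂ)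

/-- The four coordinate projections `q₀, q₁, q₂, q₃ : (T × T) × (T × T) ⟶ T`. [folklore] -/
def projFour : Fin 4 → ((T.prod T).prod (T.prod T) ⟶ T) :=
  ![AbelianVariety.fst _ _ ≫ AbelianVariety.fst T T, AbelianVariety.fst _ _ ≫ AbelianVariety.snd T T,
    AbelianVariety.snd _ _ ≫ AbelianVariety.fst T T, AbelianVariety.snd _ _ ≫ AbelianVariety.snd T T]

/-- **The companion endomorphism `φ_P` of `(T × T) × (T × T)`** for `P = x⁴ + a₃x³ + a₂x² + a₁x + a₀`:
`(x₀, x₁, x₂, x₃) ↦ (-a₀x₃, x₀ - a₁x₃, x₁ - a₂x₃, x₂ - a₃x₃)` — multiplication by `x` on `T ⊗ ℤ[x]/(P)` in the basis `1, x, x², x³`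
(Deligne's `A₀ ⊗ E` with its `E`-action). [cite: Deligne1982HodgeCycles, §4 Lemma 4.5] -/
def companionFour (a : Fin 4 → ℤ) : (T.prod T).prod (T.prod T) ⟶ (T.prod T).prod (T.prod T) :=
  AbelianVariety.prodLift
    (AbelianVariety.prodLift (-(a 0 • projFour T 3)) (projFour T 0 - a 1 • projFour T 3))
    (AbelianVariety.prodLift (projFour T 1 - a 2 • projFour T 3) (projFour T 2 - a 3 • projFour T 3))

/-- The separating endomorphism `u = (x₀, 2x₁, 4x₂, 8x₃)`. [folklore] -/
def separatingFour : (T.prod T).prod (T.prod T) ⟶ (T.prod T).prod (T.prod T) :=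
  AbelianVariety.prodLift (AbelianVariety.prodLift (projFour T 0) ((2 : ℕ) • projFour T 1))
    (AbelianVariety.prodLift ((4 : ℕ) • projFour T 2) ((8 : ℕ) • projFour T 3))

/-- The section `s₀ = (x, 0, 0, 0)` of `q₀`. [folklore] -/
def sectionFour : T ⟶ (T.prod T).prod (T.prod T) :=
  AbelianVariety.prodLift (AbelianVariety.prodLift (𝟙 T) 0) 0

variable {T}

/-- The values of `projFour`. [folklore] -/
theorem projFour_apply :
    projFour T 0 = AbelianVariety.fst _ _ ≫ AbelianVariety.fst T T ∧ projFour T 1 = AbelianVariety.fst _ _ ≫ AbelianVariety.snd T T ∧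
      projFour T 2 = AbelianVariety.snd _ _ ≫ AbelianVariety.fst T T ∧ projFour T 3 = AbelianVariety.snd _ _ ≫ AbelianVariety.snd T T :=
  ⟨rfl, rfl, rfl, rfl⟩

/-- **The companion relations**: `φ_P ≫ q₀ = -a₀·q₃` and `φ_P ≫ q_{j+1} = q_j - a_{j+1}·q₃`. [cite: Deligne1982HodgeCycles, §4 Lemma 4.5] -/
theorem companionFour_comp (a : Fin 4 → ℤ) :
    companionFour T a ≫ projFour T 0 = -(a 0 • projFour T (Fin.last 3)) ∧
      ∀ j : Fin 3, companionFour T a ≫ projFour T j.succ = projFour T (Fin.castSucc j) - a j.succ • projFour T (Fin.last 3) := by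
  obtain ⟨h0, h1, h2, h3⟩ := (projFour_apply (T := T))
  have hl : projFour T (Fin.last 3) = projFour T 3 := rfl
  refine ⟨?_, fun j => ?_⟩
  · rw [companionFour, h0, ← Category.assoc, AbelianVariety.prodLift_fst, AbelianVariety.prodLift_fst, hl]
  · fin_cases j
    · change companionFour T a ≫ projFour T 1 = projFour T 0 - a 1 • projFour T (Fin.last 3)
      rw [companionFour, h1, ← Category.assoc, AbelianVariety.prodLift_fst, AbelianVariety.prodLift_snd, hl]
    · change companionFour T a ≫ projFour T 2 = projFour T 1 - a 2 • projFour T (Fin.last 3)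
      rw [companionFour, h2, ← Category.assoc, AbelianVariety.prodLift_snd, AbelianVariety.prodLift_fst, hl]
    · change companionFour T a ≫ projFour T 3 = projFour T 2 - a 3 • projFour T (Fin.last 3)
      rw [companionFour, hl, h3, ← Category.assoc, AbelianVariety.prodLift_snd, AbelianVariety.prodLift_snd]

/-- `u ≫ q_j = 2ʲ·q_j`. [folklore] -/
theorem separatingFour_comp : ∀ j : Fin 4, separatingFour T ≫ projFour T j = (2 ^ (j : ℕ)) • projFour T j := by
  obtain ⟨h0, h1, h2, h3⟩ := (projFour_apply (T := T))
  intro j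
  fin_cases j
  · change separatingFour T ≫ projFour T 0 = (2 ^ 0) • projFour T 0
    rw [separatingFour, h0, ← Category.assoc, AbelianVariety.prodLift_fst, AbelianVariety.prodLift_fst, pow_zero, one_smul]
  · change separatingFour T ≫ projFour T 1 = (2 ^ 1) • projFour T 1
    rw [separatingFour, h1, ← Category.assoc, AbelianVariety.prodLift_fst, AbelianVariety.prodLift_snd, pow_one]
  · change separatingFour T ≫ projFour T 2 = (2 ^ 2) • projFour T 2
    rw [separatingFour, h2, ← Category.assoc, AbelianVariety.prodLift_snd, AbelianVariety.prodLift_fst]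
    norm_num
  · change separatingFour T ≫ projFour T 3 = (2 ^ 3) • projFour T 3
    rw [separatingFour, h3, ← Category.assoc, AbelianVariety.prodLift_snd, AbelianVariety.prodLift_snd]
    norm_num

/-- `s₀ ≫ q₀ = 𝟙` and `s₀ ≫ q_{j+1} = 0`. [folklore] -/
theorem sectionFour_comp :
    sectionFour T ≫ projFour T 0 = 𝟙 T ∧ ∀ j : Fin 3, sectionFour T ≫ projFour T j.succ = 0 := by
  obtain ⟨h0, h1, h2, h3⟩ := (projFour_apply (T := T))
  refine ⟨?_, fun j => ?_⟩
  · rw [h0, ← Category.assoc, sectionFour, AbelianVariety.prodLift_fst, AbelianVariety.prodLift_fst]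
  · fin_cases j
    · change sectionFour T ≫ projFour T 1 = 0
      rw [h1, ← Category.assoc, sectionFour, AbelianVariety.prodLift_fst, AbelianVariety.prodLift_snd]
    · change sectionFour T ≫ projFour T 2 = 0
      rw [h2, ← Category.assoc, sectionFour, AbelianVariety.prodLift_snd, Limits.zero_comp]
    · change sectionFour T ≫ projFour T 3 = 0
      rw [h3, ← Category.assoc, sectionFour, AbelianVariety.prodLift_snd, Limits.zero_comp]

/-- `dim ((T × T) × (T × T)) = (3+1)·dim T`. [folklore] -/
theorem dim_prodFour {g : ℕ} (hT : T.dim = g) : ((T.prod T).prod (T.prod T)).dim = (3 + 1) * g := by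
  rw [AbelianVariety.dim_prod, AbelianVariety.dim_prod, hT]; ring

/-- **`A₀ ⊗ E` for every quartic `E`: all Weil classes are algebraic.** For every complex abelian variety `T` of dimension `g ≥ 1`, every
monic quartic `P = x⁴ + a₃x³ + a₂x² + a₁x + a₀ ∈ ℤ[x]` with four DISTINCT complex roots `r₀..r₃`, and every `P' ∈ ℤ[x]`:
`weilClassesField ((T × T) × (T × T)) φ_P P' (2g) ≤ algebraicClasses _ g` — in particular (with `P' = P`) the whole Weil space
`W_E ⊗ ℂ = ⊕_σ ⋀^{2g}V_σ` of `E = ℚ[x]/(P)` acting through `φ_P`. [cite: Deligne1982HodgeCycles, §4 Lemma 4.5, Remark 4.10]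
[cite: MoonenZarhin1998WeilClasses, §1] -/
theorem weilClassesField_companionFour_le_algebraicClasses {g : ℕ} (hg : 0 < g) (hT : T.dim = g) (a : Fin 4 → ℤ)
    {r : Fin 4 → ℂ} (hr : Function.Injective r)
    (hroot : ∀ k, r k ^ 4 + ∑ j : Fin 4, (a j : ℂ) * r k ^ (j : ℕ) = 0) (P' : Polynomial ℤ) :
    weilClassesField ((T.prod T).prod (T.prod T)) (companionFour T a) P' (2 * g) ≤
      algebraicClasses ((T.prod T).prod (T.prod T)).X g := by
  obtain ⟨hq0, hqs⟩ := companionFour_comp (T := T) a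
  obtain ⟨hs₀, hs₀'⟩ := sectionFour_comp (T := T)
  exact weilClassesField_le_algebraicClasses_of_companion (q := projFour T) (a := a) (n := 3) hg hT (dim_prodFour hT) hq0 hqs
    (separatingFour_comp (T := T)) hs₀ hs₀' hr hroot P'

/-- Element form (the binder shape of the ladder's R3, `WeilClassesCMField`, at these points): every class of
`weilClassesField ((T × T) × (T × T)) φ_P P' (2g)` is algebraic — the rationality / Hodge-type hypotheses of R3 are not needed here.
[cite: Deligne1982HodgeCycles, §4 Lemma 4.5, Remark 4.10] -/
theorem mem_algebraicClasses_of_mem_weilClassesField_companionFour {g : ℕ} (hg : 0 < g) (hT : T.dim = g) (a : Fin 4 → ℤ)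
    {r : Fin 4 → ℂ} (hr : Function.Injective r)
    (hroot : ∀ k, r k ^ 4 + ∑ j : Fin 4, (a j : ℂ) * r k ^ (j : ℕ) = 0) (P' : Polynomial ℤ) :
    ∀ c ∈ weilClassesField ((T.prod T).prod (T.prod T)) (companionFour T a) P' (2 * g),
      c ∈ algebraicClasses ((T.prod T).prod (T.prod T)).X g :=
  fun _ hc => weilClassesField_companionFour_le_algebraicClasses hg hT a hr hroot P' hc

/-! ### Example: `E = ℚ(ζ₅)`, `P = x⁴ + x³ + x² + x + 1` -/

/-- The four primitive fifth roots of unity `ζ₅^{k+1}`, `k < 4`, are distinct and are roots of `x⁴ + x³ + x² + x + 1`.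
[folklore] -/
theorem zetaFive_roots :
    Function.Injective (fun k : Fin 4 => Complex.exp (2 * Real.pi * Complex.I / 5) ^ ((k : ℕ) + 1)) ∧
      ∀ k : Fin 4, (Complex.exp (2 * Real.pi * Complex.I / 5) ^ ((k : ℕ) + 1)) ^ 4 +
        ∑ j : Fin 4, ((fun _ => (1 : ℤ)) j : ℂ) * (Complex.exp (2 * Real.pi * Complex.I / 5) ^ ((k : ℕ) + 1)) ^ (j : ℕ) = 0 := by
  have hζ : IsPrimitiveRoot (Complex.exp (2 * Real.pi * Complex.I / 5)) 5 := Complex.isPrimitiveRoot_exp 5 (by norm_num)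
  refine ⟨?_, fun k => ?_⟩
  · intro k l hkl
    have h := hζ.pow_inj (Nat.succ_lt_succ (lt_of_lt_of_le k.isLt (by norm_num)))
      (Nat.succ_lt_succ (lt_of_lt_of_le l.isLt (by norm_num))) hkl
    exact Fin.ext (Nat.succ_injective h)
  · set ρ := Complex.exp (2 * Real.pi * Complex.I / 5) ^ ((k : ℕ) + 1) with hρ
    have hρ5 : ρ ^ 5 = 1 := by rw [hρ, pow_right_comm, hζ.pow_eq_one, one_pow]
    have hρ1 : ρ ≠ 1 := by
      rw [hρ]
      exact hζ.pow_ne_one_of_pos_of_lt (Nat.succ_ne_zero _) (Nat.succ_lt_succ (lt_of_lt_of_le k.isLt (by norm_num)))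
    have hgeom : (ρ - 1) * (ρ ^ 4 + ∑ j : Fin 4, ((1 : ℤ) : ℂ) * ρ ^ (j : ℕ)) = 0 := by
      rw [Fin.sum_univ_four]
      simp only [Int.cast_one, one_mul, Fin.val_zero, Fin.val_one, Fin.val_two, pow_zero, pow_one]
      have : ((3 : Fin 4) : ℕ) = 3 := rfl
      rw [this]
      linear_combination hρ5
    exact (mul_eq_zero.mp hgeom).resolve_left (sub_ne_zero.mpr hρ1)

/-- **`T ⊗ ℤ[ζ₅]`: all `ℚ(ζ₅)`-Weil classes are algebraic**, for every complex abelian variety `T` of dimension `g ≥ 1`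
(`A = (T × T) × (T × T)`, `φ = φ_P` for `P = x⁴ + x³ + x² + x + 1`; `ℚ(ζ₅)` is a CM field of degree `4 > 2`, `4·2g = 2 dim A`) — a
`g(g+1)/2`-dimensional locus of the rung R3 for `E = ℚ(ζ₅)`, fact-free. [cite: Deligne1982HodgeCycles, §4 Lemma 4.5, Remark 4.10] -/
theorem weilClassesField_zetaFive_le_algebraicClasses {g : ℕ} (hg : 0 < g) (hT : T.dim = g) (P' : Polynomial ℤ) :
    weilClassesField ((T.prod T).prod (T.prod T)) (companionFour T fun _ => 1) P' (2 * g) ≤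
      algebraicClasses ((T.prod T).prod (T.prod T)).X g :=
  weilClassesField_companionFour_le_algebraicClasses hg hT (fun _ => 1) zetaFive_roots.1 zetaFive_roots.2 P'

end HodgeTheory

end Literature.AlgebraicGeometry.HodgeTheory

end
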